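import Summits.CriticalPhenomena.PercolationContinuityZ3.Theorems.PercNearOneGluingNoHeavyLowerTailThreePointProductFormOneStep
import HarnessLib

/-!
# The product form (P) for the tree recursion of the class `H − {s,c}` acyclic (Sahi programme, prover prim-sahi-p2 gen 59)

Support file (`--supports stmt-CriticalPhenomena-4575`, helper); uses `…ThreePointProductFormOneStep` (the one-step lemma, same gen).
Standard axioms, no sorries, no named facts, no definitions.  Memo `run/shared/lean/prim/prim-sahi/FROM-prim-sahi-p2-gen59-ONE-STEP-LEMMA.md`,
`prim-sahi-p2/PROOF-E3.md` §68 (68j) and §69.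

THE RECURSION (gen 58, PROOF-E3 (68j); validated against brute-force enumeration).  Let `H` be a finite SIMPLE graph with distinct vertices
`s, a, c` such that `H − {s,c}` is a tree, rooted at the apex `a`; mark a tree vertex `v` by `A(v) = [v ~ s]`, `B(v) = [v ~ c]`.  For the
sub-instance at `v` (the subtree of `v`, apex `v`, the `s`- and `c`-edges into it) put `r_v = #S0`, `p_v = #P1 + #S0`, `q_v = #P2 + #S0`,
`g_v = #good = #S0 − #bad` (fibre language of gens 53–58: `S0 = s|v|c`, `P1 = sv|c`, `P2 = vc|s`, `bad = {T ∈ S0 : s ↔ c in ♭T}`).  Then over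
the children `u` of `v`:
`r_v = ∏ (p_u + q_u)`, `p_v = 2^{A(v)} ∏ (2p_u + q_u − r_u)`, `q_v = 2^{B(v)} ∏ (p_u + 2q_u − r_u)`,
`g_v = ∏(p_u+g_u) + ∏(q_u+g_u) − ∏(r_u+g_u)` (`v` unmarked) `| ∏(p_u+g_u)` (`A` only) `| ∏(q_u+g_u)` (`B` only) `| 0` (both).
* **`productForm_of_treeRecursion`** [this work] — for ANY real solution of this recursion on a finite rooted forest (children `ch v`, a height
  function decreasing along child edges): at every vertex `0 ≤ r_v ≤ p_v`, `r_v ≤ q_v`, `0 ≤ g_v` and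
  **`(r_v − g_v)² ≤ (p_v − r_v)(q_v − r_v)`**, i.e. `#bad² ≤ #P1 · #P2` — CONJECTURE (P) at every vertex of every tree-like fibre, by induction
  with the one-step lemma (`oneStep_productForm`, `…_marked`, `…_marked'`) applied to `(a,b,d,n)_u = (p_u − r_u, q_u − r_u, r_u − g_u, r_u + g_u)`.
The identification of `(r, p, q, g)` with the fibre counts of a graph is NOT formalised here (it is the exact tree DP of gen 58, `lab/treedp_all.py` /
`t16_vertexP.py`, cross-checked against brute force); this file is the algebraic induction.
[this work] (gen 59).
-/

namespace Summit.CriticalPhenomena.PercolationContinuityZ3.Theorems.ProductFormOneStep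

open Finset

/-! ### 1. Finset forms of the one-step lemma (children indexed by a `Finset`) -/

section FinsetForms

variable {κ : Type*} [DecidableEq κ]

/-- One-step lemma over a `Finset` of children, in the variables of the tree recursion:
`(∏(p+q) − ∏(p+g) − ∏(q+g) + ∏(r+g))² ≤ (∏(2p+q−r) − ∏(p+q))·(∏(p+2q−r) − ∏(p+q))`
whenever `r ≤ p`, `r ≤ q`, `0 ≤ g`, `(r−g)² ≤ (p−r)(q−r)` at every child. [this work] -/
theorem oneStep_tree (s : Finset κ) (r p q g : κ → ℝ) (hrp : ∀ u ∈ s, r u ≤ p u) (hrq : ∀ u ∈ s, r u ≤ q u)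
    (hg : ∀ u ∈ s, 0 ≤ g u) (hP : ∀ u ∈ s, (r u - g u) ^ 2 ≤ (p u - r u) * (q u - r u)) :
    ((∏ u ∈ s, (p u + q u)) - (∏ u ∈ s, (q u + g u)) - (∏ u ∈ s, (p u + g u)) + ∏ u ∈ s, (r u + g u)) ^ 2 ≤
    ((∏ u ∈ s, (2 * p u + q u - r u)) - ∏ u ∈ s, (p u + q u)) *
    ((∏ u ∈ s, (p u + 2 * q u - r u)) - ∏ u ∈ s, (p u + q u)) := by
  have h := oneStep_productForm (ι := s) (fun i => p i.1 - r i.1) (fun i => q i.1 - r i.1) (fun i => r i.1 - g i.1)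
    (fun i => r i.1 + g i.1) (fun i => by simpa using hrp i.1 i.2) (fun i => by simpa using hrq i.1 i.2)
    (fun i => by have := hg i.1 i.2; linarith) (fun i => hP i.1 i.2)
  have k1 : ∏ i : s, (p i.1 - r i.1 + (q i.1 - r i.1) + (r i.1 - g i.1) + (r i.1 + g i.1)) = ∏ i : s, (p i.1 + q i.1) :=
    Finset.prod_congr rfl fun i _ => by ring
  have k2 : ∏ i : s, (q i.1 - r i.1 + (r i.1 + g i.1)) = ∏ i : s, (q i.1 + g i.1) := Finset.prod_congr rfl fun i _ => by ring
  have k3 : ∏ i : s, (p i.1 - r i.1 + (r i.1 + g i.1)) = ∏ i : s, (p i.1 + g i.1) := Finset.prod_congr rfl fun i _ => by ring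
  have k5 : ∏ i : s, (2 * (p i.1 - r i.1) + (q i.1 - r i.1) + (r i.1 - g i.1) + (r i.1 + g i.1)) = ∏ i : s, (2 * p i.1 + q i.1 - r i.1) :=
    Finset.prod_congr rfl fun i _ => by ring
  have k6 : ∏ i : s, (p i.1 - r i.1 + 2 * (q i.1 - r i.1) + (r i.1 - g i.1) + (r i.1 + g i.1)) = ∏ i : s, (p i.1 + 2 * q i.1 - r i.1) :=
    Finset.prod_congr rfl fun i _ => by ring
  rw [k1, k2, k3, k5, k6] at h
  rw [Finset.prod_coe_sort s (fun u => p u + q u), Finset.prod_coe_sort s (fun u => q u + g u),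
    Finset.prod_coe_sort s (fun u => p u + g u), Finset.prod_coe_sort s (fun u => r u + g u),
    Finset.prod_coe_sort s (fun u => 2 * p u + q u - r u), Finset.prod_coe_sort s (fun u => p u + 2 * q u - r u)] at h
  exact h

/-- One-step lemma over a `Finset`, vertex joined to `s`: `(∏(p+q) − ∏(p+g))² ≤ ∏(2p+q−r)·(∏(p+2q−r) − ∏(p+q))`. [this work] -/
theorem oneStep_tree_marked (s : Finset κ) (r p q g : κ → ℝ) (hrp : ∀ u ∈ s, r u ≤ p u) (hrq : ∀ u ∈ s, r u ≤ q u)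
    (hg : ∀ u ∈ s, 0 ≤ g u) (hP : ∀ u ∈ s, (r u - g u) ^ 2 ≤ (p u - r u) * (q u - r u)) :
    ((∏ u ∈ s, (p u + q u)) - ∏ u ∈ s, (p u + g u)) ^ 2 ≤
    (∏ u ∈ s, (2 * p u + q u - r u)) * ((∏ u ∈ s, (p u + 2 * q u - r u)) - ∏ u ∈ s, (p u + q u)) := by
  have h := oneStep_productForm_marked (ι := s) (fun i => p i.1 - r i.1) (fun i => q i.1 - r i.1) (fun i => r i.1 - g i.1)
    (fun i => r i.1 + g i.1) (fun i => by simpa using hrp i.1 i.2) (fun i => by simpa using hrq i.1 i.2)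
    (fun i => by have := hg i.1 i.2; linarith) (fun i => hP i.1 i.2)
  have k1 : ∏ i : s, (p i.1 - r i.1 + (q i.1 - r i.1) + (r i.1 - g i.1) + (r i.1 + g i.1)) = ∏ i : s, (p i.1 + q i.1) :=
    Finset.prod_congr rfl fun i _ => by ring
  have k3 : ∏ i : s, (p i.1 - r i.1 + (r i.1 + g i.1)) = ∏ i : s, (p i.1 + g i.1) := Finset.prod_congr rfl fun i _ => by ring
  have k5 : ∏ i : s, (2 * (p i.1 - r i.1) + (q i.1 - r i.1) + (r i.1 - g i.1) + (r i.1 + g i.1)) = ∏ i : s, (2 * p i.1 + q i.1 - r i.1) :=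
    Finset.prod_congr rfl fun i _ => by ring
  have k6 : ∏ i : s, (p i.1 - r i.1 + 2 * (q i.1 - r i.1) + (r i.1 - g i.1) + (r i.1 + g i.1)) = ∏ i : s, (p i.1 + 2 * q i.1 - r i.1) :=
    Finset.prod_congr rfl fun i _ => by ring
  rw [k1, k3, k5, k6] at h
  rw [Finset.prod_coe_sort s (fun u => p u + q u), Finset.prod_coe_sort s (fun u => p u + g u),
    Finset.prod_coe_sort s (fun u => 2 * p u + q u - r u), Finset.prod_coe_sort s (fun u => p u + 2 * q u - r u)] at h
  exact h

/-- One-step lemma over a `Finset`, vertex joined to `c`: `(∏(p+q) − ∏(q+g))² ≤ (∏(2p+q−r) − ∏(p+q))·∏(p+2q−r)`. [this work] -/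
theorem oneStep_tree_marked' (s : Finset κ) (r p q g : κ → ℝ) (hrp : ∀ u ∈ s, r u ≤ p u) (hrq : ∀ u ∈ s, r u ≤ q u)
    (hg : ∀ u ∈ s, 0 ≤ g u) (hP : ∀ u ∈ s, (r u - g u) ^ 2 ≤ (p u - r u) * (q u - r u)) :
    ((∏ u ∈ s, (p u + q u)) - ∏ u ∈ s, (q u + g u)) ^ 2 ≤
    ((∏ u ∈ s, (2 * p u + q u - r u)) - ∏ u ∈ s, (p u + q u)) * (∏ u ∈ s, (p u + 2 * q u - r u)) := by
  have h := oneStep_productForm_marked' (ι := s) (fun i => p i.1 - r i.1) (fun i => q i.1 - r i.1) (fun i => r i.1 - g i.1)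
    (fun i => r i.1 + g i.1) (fun i => by simpa using hrp i.1 i.2) (fun i => by simpa using hrq i.1 i.2)
    (fun i => by have := hg i.1 i.2; linarith) (fun i => hP i.1 i.2)
  have k1 : ∏ i : s, (p i.1 - r i.1 + (q i.1 - r i.1) + (r i.1 - g i.1) + (r i.1 + g i.1)) = ∏ i : s, (p i.1 + q i.1) :=
    Finset.prod_congr rfl fun i _ => by ring
  have k2 : ∏ i : s, (q i.1 - r i.1 + (r i.1 + g i.1)) = ∏ i : s, (q i.1 + g i.1) := Finset.prod_congr rfl fun i _ => by ring
  have k5 : ∏ i : s, (2 * (p i.1 - r i.1) + (q i.1 - r i.1) + (r i.1 - g i.1) + (r i.1 + g i.1)) = ∏ i : s, (2 * p i.1 + q i.1 - r i.1) :=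
    Finset.prod_congr rfl fun i _ => by ring
  have k6 : ∏ i : s, (p i.1 - r i.1 + 2 * (q i.1 - r i.1) + (r i.1 - g i.1) + (r i.1 + g i.1)) = ∏ i : s, (p i.1 + 2 * q i.1 - r i.1) :=
    Finset.prod_congr rfl fun i _ => by ring
  rw [k1, k2, k5, k6] at h
  rw [Finset.prod_coe_sort s (fun u => p u + q u), Finset.prod_coe_sort s (fun u => q u + g u),
    Finset.prod_coe_sort s (fun u => 2 * p u + q u - r u), Finset.prod_coe_sort s (fun u => p u + 2 * q u - r u)] at h
  exact h

end FinsetForms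

/-! ### 2. The induction over the tree -/

section Tree

variable {V : Type*} [DecidableEq V]

set_option maxHeartbeats 400000 in
/-- **(P) AT EVERY VERTEX OF THE TREE RECURSION.**  On a finite rooted forest (children `ch v`, height `ht` strictly decreasing from a vertex
to its children) let real `r, p, q, g` solve the gen-58 recursion with marks `mA` (`v ~ s`) and `mB` (`v ~ c`).  Then at every vertex
`0 ≤ r ≤ p`, `r ≤ q`, `0 ≤ g` and `(r − g)² ≤ (p − r)·(q − r)` — the product form `#bad² ≤ #P1·#P2` of the sub-instance. [this work] -/
theorem productForm_of_treeRecursion (ch : V → Finset V) (ht : V → ℕ) (hht : ∀ v, ∀ u ∈ ch v, ht u < ht v)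
    (mA mB : V → Bool) (r p q g : V → ℝ)
    (hr : ∀ v, r v = ∏ u ∈ ch v, (p u + q u))
    (hp : ∀ v, p v = (if mA v then 2 else 1) * ∏ u ∈ ch v, (2 * p u + q u - r u))
    (hq : ∀ v, q v = (if mB v then 2 else 1) * ∏ u ∈ ch v, (p u + 2 * q u - r u))
    (hg : ∀ v, g v = if mA v then (if mB v then 0 else ∏ u ∈ ch v, (p u + g u))
      else (if mB v then ∏ u ∈ ch v, (q u + g u)
        else (∏ u ∈ ch v, (p u + g u)) + (∏ u ∈ ch v, (q u + g u)) - ∏ u ∈ ch v, (r u + g u)))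
    (v : V) :
    0 ≤ r v ∧ r v ≤ p v ∧ r v ≤ q v ∧ 0 ≤ g v ∧ (r v - g v) ^ 2 ≤ (p v - r v) * (q v - r v) := by
  -- strong induction on the height
  suffices H : ∀ N : ℕ, ∀ v, ht v ≤ N →
      0 ≤ r v ∧ r v ≤ p v ∧ r v ≤ q v ∧ 0 ≤ g v ∧ (r v - g v) ^ 2 ≤ (p v - r v) * (q v - r v) from H (ht v) v le_rfl
  intro N
  induction N with
  | zero =>
    intro v hv
    -- no children
    have hch : ch v = ∅ := by
      rcases (ch v).eq_empty_or_nonempty with h | ⟨u, hu⟩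
      · exact h
      · exact absurd (hht v u hu) (by omega)
    have hr' := hr v; have hp' := hp v; have hq' := hq v; have hg' := hg v
    rw [hch] at hr' hp' hq' hg'
    simp only [Finset.prod_empty, mul_one] at hr' hp' hq' hg'
    refine ⟨by rw [hr']; norm_num, ?_, ?_, ?_, ?_⟩
    · rw [hr', hp']; split_ifs <;> norm_num
    · rw [hr', hq']; split_ifs <;> norm_num
    · rw [hg']; split_ifs <;> norm_num
    · rw [hr', hp', hq', hg']
      cases mA v <;> cases mB v <;> norm_num
  | succ N ih =>
    intro v hv
    -- the children satisfy the induction hypothesis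
    have IH : ∀ u ∈ ch v, 0 ≤ r u ∧ r u ≤ p u ∧ r u ≤ q u ∧ 0 ≤ g u ∧ (r u - g u) ^ 2 ≤ (p u - r u) * (q u - r u) :=
      fun u hu => ih u (by have := hht v u hu; omega)
    have hrp : ∀ u ∈ ch v, r u ≤ p u := fun u hu => (IH u hu).2.1
    have hrq : ∀ u ∈ ch v, r u ≤ q u := fun u hu => (IH u hu).2.2.1
    have hgu : ∀ u ∈ ch v, 0 ≤ g u := fun u hu => (IH u hu).2.2.2.1
    have hPu : ∀ u ∈ ch v, (r u - g u) ^ 2 ≤ (p u - r u) * (q u - r u) := fun u hu => (IH u hu).2.2.2.2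
    have hr0 : ∀ u ∈ ch v, 0 ≤ r u := fun u hu => (IH u hu).1
    -- the products and their order relations
    have hσ0 : 0 ≤ ∏ u ∈ ch v, (p u + q u) :=
      Finset.prod_nonneg fun u hu => by linarith [hr0 u hu, hrp u hu, hrq u hu]
    have hσA : ∏ u ∈ ch v, (p u + q u) ≤ ∏ u ∈ ch v, (2 * p u + q u - r u) :=
      Finset.prod_le_prod (fun u hu => by linarith [hr0 u hu, hrp u hu, hrq u hu]) (fun u hu => by linarith [hrp u hu])
    have hσB : ∏ u ∈ ch v, (p u + q u) ≤ ∏ u ∈ ch v, (p u + 2 * q u - r u) :=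
      Finset.prod_le_prod (fun u hu => by linarith [hr0 u hu, hrp u hu, hrq u hu]) (fun u hu => by linarith [hrq u hu])
    have hA0 : 0 ≤ ∏ u ∈ ch v, (2 * p u + q u - r u) := hσ0.trans hσA
    have hB0 : 0 ≤ ∏ u ∈ ch v, (p u + 2 * q u - r u) := hσ0.trans hσB
    have hPG0 : 0 ≤ ∏ u ∈ ch v, (p u + g u) :=
      Finset.prod_nonneg fun u hu => by linarith [hr0 u hu, hrp u hu, hgu u hu]
    have hQG0 : 0 ≤ ∏ u ∈ ch v, (q u + g u) :=
      Finset.prod_nonneg fun u hu => by linarith [hr0 u hu, hrq u hu, hgu u hu]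
    have hRGQG : ∏ u ∈ ch v, (r u + g u) ≤ ∏ u ∈ ch v, (q u + g u) :=
      Finset.prod_le_prod (fun u hu => by linarith [hr0 u hu, hgu u hu]) (fun u hu => by linarith [hrq u hu])
    have h1 := oneStep_tree (ch v) r p q g hrp hrq hgu hPu
    have h2 := oneStep_tree_marked (ch v) r p q g hrp hrq hgu hPu
    have h3 := oneStep_tree_marked' (ch v) r p q g hrp hrq hgu hPu
    have hr' := hr v; have hp' := hp v; have hq' := hq v; have hg' := hg v
    -- abbreviate
    set S := ∏ u ∈ ch v, (p u + q u) with hS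
    set PA := ∏ u ∈ ch v, (2 * p u + q u - r u) with hPA
    set PB := ∏ u ∈ ch v, (p u + 2 * q u - r u) with hPB
    set PG := ∏ u ∈ ch v, (p u + g u) with hPG
    set QG := ∏ u ∈ ch v, (q u + g u) with hQG
    set RG := ∏ u ∈ ch v, (r u + g u) with hRG
    refine ⟨by rw [hr']; exact hσ0, ?_, ?_, ?_, ?_⟩
    · rw [hr', hp']; split_ifs <;> nlinarith
    · rw [hr', hq']; split_ifs <;> nlinarith
    · rw [hg']; split_ifs <;> nlinarith
    · rw [hr', hp', hq', hg']
      cases hA : mA v <;> cases hB : mB v <;> simp only [Bool.false_eq_true, ↓reduceIte, one_mul]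
      · -- unmarked
        have e : S - (PG + QG - RG) = S - QG - PG + RG := by ring
        rw [e]; exact h1
      · -- mB only
        calc (S - QG) ^ 2 ≤ (PA - S) * PB := h3
          _ ≤ (PA - S) * (2 * PB - S) := by
              apply mul_le_mul_of_nonneg_left _ (by linarith)
              linarith
      · -- mA only
        calc (S - PG) ^ 2 ≤ PA * (PB - S) := h2
          _ ≤ (2 * PA - S) * (PB - S) := by
              apply mul_le_mul_of_nonneg_right _ (by linarith)
              linarith
      · -- both
        rw [sub_zero]
        calc S ^ 2 = S * S := sq S
          _ ≤ (2 * PA - S) * (2 * PB - S) := mul_le_mul (by linarith) (by linarith) hσ0 (by linarith)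

end Tree

end Summit.CriticalPhenomena.PercolationContinuityZ3.Theorems.ProductFormOneStep
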